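import Mathlib.AlgebraicGeometry.EllipticCurve.LFunction
import Literature.NumberTheory.Automorphic.BrandtXi
import Literature.NumberTheory.EllipticCurves.ModularCurve
import Literature.NumberTheory.EllipticCurves.GaloisAction
import Literature.NumberTheory.DiophantineGeometry.MinimalDiscriminant
import Literature.NumberTheory.DiophantineGeometry.Conductor
import HarnessLib

/-!
# Pollack–Weston: the modular degree versus the definite congruence number `ξ(N⁺, N⁻)`

Topic `NumberTheory/Automorphic`; one NAMED FACT (no proof), requested by route `ABC/DefiniteXi`
(items `DefiniteRTControl`, `XiStrongBound`) over the definition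
`Literature.NumberTheory.Automorphic.brandtXi` of `Literature/NumberTheory/Automorphic/BrandtXi.lean`
(the definite congruence number `ξ = ∑ w_i φ_i²` on a generator `φ` of the Hecke eigen-lattice in
the Brandt module `ℤ[Cls O]` of an Eichler order `O` of level `N⁺` in the definite quaternion
algebra of discriminant `N⁻`; `Brandt.XiSetup`, `Brandt.xi`, `Brandt.eigenLattice`).

**Source, as printed** (R. Pollack, T. Weston, *On anticyclotomic μ-invariants of modular
forms*, Compositio Math. 147 (2011) = arXiv:math/0610694). Standing notation (§ Notation): `p` an
odd prime, `f = ∑ a_n q^n` a normalised newform of weight two and squarefree level `N = N⁺N⁻`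
prime to `p`, `N⁻` with an odd number of prime factors, `𝒪` the (`p`-adic) coefficient ring of
`f`, `𝔭` its maximal ideal. §2.1: `X_{N⁺,N⁻}` "the Shimura curve of level `N⁺` attached to the
definite quaternion algebra ramified at the primes dividing `N⁻`", `M = Pic(X_{N⁺,N⁻}) ⊗ ℤ_p`
with the faithful action of the Hecke algebra `𝕋` and "an intersection pairing `⟨·,·⟩` under
which the action of `𝕋` is adjoint", `M^f` the (rank-one) submodule of `M ⊗ 𝒪` on which `𝕋`
acts through `f`, `g_f` a generator, **`ξ_f(N⁺,N⁻) := ⟨g_f, g_f⟩`**. §2.2: the congruence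
number `η_f(N₁,N₂)` = a generator of `π_f(Ann_𝕋(ker π_f)) 𝒪`, `η_f(N) = η_f(N,1)`. Def. 3.3:
the **Tamagawa exponent** `t_f(ℓ)` = the largest `t` such that `A_f[𝔭^t]` is unramified at `ℓ`
(`A_f` the divisible Galois module of `f`), "which for an elliptic curve is simply the `p`-adic
valuation of the Tamagawa factor at `q`" (p. 2). Hypothesis **CR** for `(ρ̄, N⁻)` (p. 2): `ρ̄`
is surjective, and `ρ̄` is ramified at every `q ∣ N⁻` with `q ≡ ±1 (mod p)`.

> **Theorem 6.8.** Let `f` be a modular form of weight two and squarefree level `N = N⁺N⁻`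
> with `N⁻` the product of an odd number of primes. Assume that `(ρ̄_f, N⁻)` satisfies
> hypothesis CR. Then `ord_𝔭(η_f(N) / ξ_f(N⁺,N⁻)) = ∑_{ℓ ∣ N⁻} t_f(ℓ)`.

(Proof, §6.5: Prop. 6.5 [Kohel] `Pic(X_{N⁺,N⁻}) ⊗ 𝒪 ≅ 𝒳_r(N⁺r, N⁻/r)` matching the
intersection pairing with the monodromy pairing; Prop. 6.6 [Takahashi]; Ribet–Takahashi
[RT] Thm. 1.) **Proposition 6.7** (same hypotheses): `(δ_f(N)) = (η_f(N))` as `𝒪`-ideals, where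
`δ_f(N)` is the scalar by which `ξ^* ξ_*` acts for the optimal quotient `ξ : J₀(N) → A_f`.

**What is vendored** (`thm_6_8_ellipticCurve`): the case of a newform with *integer*
eigenvalues, i.e. of an elliptic curve `E/ℚ` (modularity), rewritten through the following
standard identifications, each recorded here so that a reviewer can check faithfulness:
(i) `A_f = E[p^∞]` (all `G_ℚ`-stable lattices are homothetic since `ρ̄_{E,p}` is irreducible),
so `ρ̄_f = ρ̄_{E,p} : G_ℚ → GL₂(𝔽_p)` and "surjective" is `HasSurjectiveModNGaloisRep`;
(ii) for `q ∥ N` (multiplicative reduction) `E[p^t]` is unramified at `q` iff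
`p^t ∣ ord_q(Δ_min(E))` (Tate curve), hence `t_f(q) = ord_p(ord_q Δ_min(E))` and "`ρ̄`
ramified at `q`" is `p ∤ ord_q Δ_min(E)`;
(iii) `δ_f(N) =` the modular degree of the optimal (strong Weil) parametrisation
`X₀(N) → E₀` in the isogeny class, expressed isogeny-free exactly as in
`ModularParametrizationData.abs_maninConstant_eq_one_of_isSemistable`: a parametrisation datum
`D` of `E` at level `N` whose degree is minimal among all data with the same newform;
with Prop. 6.7, `ord_p η_f(N) = ord_p D.modularDegree`;
(iv) `Pic(X_{N⁺,N⁻}) = ℤ[Cl(O)]` for an Eichler order `O` of level `N⁺` in the definite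
quaternion algebra of discriminant `N⁻`, with the intersection pairing = Gross's height pairing
`⟨e_i, e_j⟩ = w_i δ_ij`, `w_i = |O_l(I_i)ˣ|/2` (Gross 1987 §4; Bertolini–Darmon; via Prop. 6.5
it is the monodromy pairing, whose weights are the orders of the stabilisers modulo `±1`), and
`M^f ∩ Pic = ` the eigen-lattice of `(a_n(E))_n` cut out by the `T_ℓ`, `ℓ ∤ N`
(`Brandt.eigenLattice`; a saturated line by strong multiplicity one, and equal to the lattice cut
out by the full Hecke algebra since both are saturated with the same `ℚ`-span), so that
`ord_p ξ_f(N⁺,N⁻) = ord_p (brandtXi N⁺ N⁻ (a_n(E))_n)` for every `p` (`Brandt.xi`, `brandtXi`;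
the value is taken on a chosen `Brandt.XiSetup`, all setups giving isomorphic Brandt data);
(v) `p ≥ 5`: the paper's standing `p` is odd (Notation) and its introduction fixes `p ≥ 5` for
elliptic curves; we state the (weaker) `p ≥ 5` version;
(vi) `N` squarefree with `p ∤ N`, `N⁻ ∣ N` with an odd number of prime factors (`ω`), and the
imaginary quadratic field `K` of the paper (which only labels `N^±`) is suppressed: for any such
factorisation a `K` with the required splitting exists (quadratic reciprocity and Dirichlet).

Conclusion in valuations: `ord_p(deg φ_{E₀}) = ord_p ξ(E; N⁺,N⁻) + ∑_{q ∣ N⁻} ord_p(ord_q Δ_min E)`.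
Related: Ribet–Takahashi 1997 Thm. 1 and Takahashi 2001 (degrees of Shimura-curve
parametrisations), Böckle–Khare–Manning 2021 (Wiles defect: the analogue with `ρ̄` only
irreducible, correction terms at `q ∣ N⁻` with `q ≡ ±1`), Agashe–Ribet–Stein 2012 Thm. 2.1
(`deg φ ∣ η_f`, equality away from `p² ∣ 4N`) — none of these is asserted here.

## References

* R. Pollack, T. Weston, Compositio Math. 147 (2011) 1353–1381, §2.1–2.2, Def. 3.3, Prop. 6.5,
  6.7, Thm. 6.8 [PollackWeston2011].
* K. Ribet, S. Takahashi, PNAS 94 (1997), Thm. 1 [RibetTakahashi1997].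
* B. H. Gross, *Heights and the special values of L-series* (1987), §§1–4 [Gross1987].
* A. Pizer, J. Algebra 64 (1980), §2 [Pizer1980].
-/

noncomputable section

open scoped BigOperators

namespace Literature.NumberTheory.Automorphic

namespace PollackWeston2011

open Literature.NumberTheory.EllipticCurves.ModularForms

/-- **Pollack–Weston 2011, Theorem 6.8 with Proposition 6.7, for elliptic curves** (see the
module docstring for the printed statement and the identifications (i)–(vi) used).
Let `E/ℚ` be an elliptic curve (any Weierstrass model `W`) of squarefree conductor
`N = N⁺ · N⁻`, where `N⁻` has an odd number of prime factors; let `p ≥ 5` be a prime with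
`p ∤ N` such that (CR) the mod-`p` representation `ρ̄_{E,p}` is surjective and, for every prime
`q ∣ N⁻` with `q ≡ ±1 (mod p)`, `p ∤ ord_q(Δ_min(E))` (i.e. `ρ̄_{E,p}` is ramified at `q`). Let
`D` be a modular parametrisation datum of `E` at level `N` of minimal degree among all data with
the same newform (the optimal parametrisation of the strong Weil curve, up to automorphism).
Then
`ord_p(deg D) = ord_p(ξ(E; N⁺, N⁻)) + ∑_{q ∣ N⁻} ord_p(ord_q Δ_min(E))`,
where `ξ(E; N⁺, N⁻) = brandtXi N⁺ N⁻ (n ↦ a_n(E))` is the definite congruence number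
(`⟨g_f, g_f⟩` in `Pic(X_{N⁺,N⁻})`, PW §2.1) and `a_n(E)` are the coefficients of the
`L`-function of `E` (Mathlib `WeierstrassCurve.LFunction`). As printed: `ord_𝔭(η_f(N)/ξ_f(N⁺,N⁻))
= ∑_{ℓ ∣ N⁻} t_f(ℓ)` (Thm. 6.8) and `(δ_f(N)) = (η_f(N))` (Prop. 6.7). [cite: PollackWeston2011, Thm. 6.8 and Prop. 6.7 (with §2.1, Def. 3.3)] -/
def thm_6_8_ellipticCurve : Prop :=
  ∀ (W : WeierstrassCurve ℚ) [W.IsElliptic] (Nplus Nminus : ℕ) [NeZero (Nplus * Nminus)],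
    W.conductorNorm ℤ = Nplus * Nminus →
    Squarefree (Nplus * Nminus) →
    Odd Nminus.primeFactors.card →
    ∀ p : ℕ, p.Prime → 5 ≤ p → ¬ p ∣ Nplus * Nminus →
    W.HasSurjectiveModNGaloisRep (p : ℤ) →
    (∀ q ∈ Nminus.primeFactors, ((q : ZMod p) = 1 ∨ (q : ZMod p) = -1) →
      ¬ p ∣ (W.minimalDiscriminantNorm ℤ).factorization q) →
    ∀ D : ModularParametrizationData W (Nplus * Nminus),
      (∀ (W' : WeierstrassCurve ℚ) [W'.IsElliptic]
          (D' : ModularParametrizationData W' (Nplus * Nminus)),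
          D'.f = D.f → D.modularDegree ≤ D'.modularDegree) →
      D.modularDegree.factorization p =
        (brandtXi Nplus Nminus (fun n => W.LFunction n)).factorization p +
          ∑ q ∈ Nminus.primeFactors, ((W.minimalDiscriminantNorm ℤ).factorization q).factorization p

end PollackWeston2011

end Literature.NumberTheory.Automorphic
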